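import Summits.BirchSwinnertonDyer.BirchSwinnertonDyer.Theorems.CMKolyvaginAtInertTwoHabitatByItemsAtTwo
import Summits.BirchSwinnertonDyer.BirchSwinnertonDyer.Theorems.CMKolyvaginAtInertTwoGenusDefectBSDConsistencyAtTwo
import HarnessLib

/-!
# Route `CMKolyvaginAtInertTwo` (leaf `WAllCornerFTwo`, habitat H₂) — ON `Ш(E/ℚ)[2] = 0` THE OPEN BIT IS ONE PRIME-TWIST HEEGNER STATEMENT:
# `BSD₂(E) ⟺ (∀ / ∃ Mazur–Rubin prime ℓ) the Heegner point of E over ℚ(√−ℓ) is not 2-divisible` (mod prints)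

Seat `bsd-line-cmk2-p1` g24 (cell `bsd-print-cf2`), `--supports stmt-BirchSwinnertonDyer-28176` (helper; closes nothing by name).
THEOREMS ONLY (no definition, no named fact, no `sorry`).  BSD is NOT proved by this.

A MAZUR–RUBIN PRIME of `W ∈ H₂` (CM, `2` inert in `F`, `ρ̄_{W,2}` onto — so `Δ_W < 0`, `W(ℚ)[2] = 0`, `Gal(ℚ(W[2])/ℚ) ≅ S₃`) with
`#Sel₂(W/ℚ) = 2` is a prime `ℓ ≡ 7 (mod 8)` with `4N_W ∣ ℓ + 1` at which `Sel₂(W/ℚ)` is NOT strict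
(`¬ Sel₂(W) ≤ strictLocalKer_ℓ`, i.e. the generator `P₀` of `W(ℚ)/tors` is not `2`-divisible in `W(ℚ_ℓ)`); such primes exist with Čebotarev
density (GK2 tree theorem `GenusKolyTwistingPrime.exists_twistingPrime_not_selmerGroup_le_strictLocalKer`).  For `K = ℚ(√−ℓ)`: `d_K = −ℓ` odd
`≠ −3`, Heegner for `N_W`, `2` split, `Σ_W(d_K) = 1`, `#Sel₂(W^{(−ℓ)}) = 1` (Mazur–Rubin Cor. 3.4 (i), tree theorem), hence `L(W^{(−ℓ)},1) ≠ 0`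
(Burungale–Tian 2026 + modularity) and — by g15's count identity — `Ш(W_K)(2) = ⊥`.

* `R0MR W` below is NOT a definition but the displayed hypothesis «for every Mazur–Rubin prime `ℓ` of `W`, every imaginary quadratic `K` with
  `d_K = −ℓ` (Heegner for `N_W`, `2` split) and every optimal odd-Manin frame `(Dt, β, ι, d₁)` with `y_K = P(1)` of infinite order:
  `y_K ∉ 2W(K[1])`» — R0 (28176) AT `W` restricted to Mazur–Rubin prime fields, with NO `Ш`-hypothesis left (it is automatic there).
* §2 `bsdp_two_of_natCard_selmerGroup_eq_two_of_mazurRubinPrimeR0_of_printedInputs`: six prints ∧ R0MR_W ⟹ `BSDp W 2` on `#Sel₂(W) = 2`.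
* §3 `mazurRubinPrimeR0_of_bsdp_of_printedInputs`: six prints ∧ `BSDp W 2` ⟹ R0MR_W (per-curve BSD-truth, g21's consistency identity).
* §4 `bsdp_two_iff_mazurRubinPrimeR0_of_printedInputs`: on `H₂ ∩ {#Sel₂(E/ℚ) = 2}`, **`BSDp W 2 ↔ R0MR_W`** (mod the six prints) — and since MR
  primes exist, «for ONE MR prime» already decides (`bsdp_two_of_exists_mazurRubinPrime_primitive_of_printedInputs`).
So the residual of the route on `Ш(E/ℚ)[2] = 0` is, per curve, exactly: «the Heegner point of `E` over `ℚ(√−ℓ)` is `2`-primitive for one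
(equivalently every) Mazur–Rubin prime `ℓ`» — a statement about PRIME quadratic twists in one Čebotarev class, with `2` SPLIT in `K`
(Kriz–Li's Assumption (★) frame).  Nothing here proves it.

References: [MazurRubin2010] Cor. 3.4 (i), Prop. 3.3, Lemma 3.5; [BurungaleTian2026] Thm. 1.1; [BurungaleFlach2024] Thm. 1.1, Cor. 2;
[GrossZagier1986] I (6.3), V §2; [Milne1972ArithmeticAV] Thm. 1; [Kramer1981] Prop. 3; [GrossLMS1991] §2–§4; [KrizLi2019] §1.3 (Assumption (★)).
-/

set_option autoImplicit false
-- the Theorems namespace of this sub repeats the summit name by design (D-0017 nested layout)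
set_option linter.dupNamespace false

noncomputable section

open scoped Classical

open WeierstrassCurve NumberField Literature.NumberTheory.EllipticCurves
  Literature.NumberTheory.EllipticCurves.ModularForms
  Literature.NumberTheory.EllipticCurves.Rank1Residual
  Summit.BirchSwinnertonDyer.Rank1Residual
open Summit.BirchSwinnertonDyer.BirchSwinnertonDyer.Theorems.CMExactDescent

namespace Summit.BirchSwinnertonDyer.BirchSwinnertonDyer.Theorems.KolyvaginLowerTwo

/-! ## §1 Mazur–Rubin primes exist; the Mazur–Rubin field of a given prime -/

/-- **Mazur–Rubin primes exist** for `W` with CM, `2` inert in the CM field, `ρ̄_{W,2}` onto and `#Sel₂(W/ℚ) = 2`: a prime `ℓ ≡ 7 (mod 8)`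
with `4N_W ∣ ℓ + 1` at which `Sel₂(W)` is not strict (GK2's Čebotarev theorem, restated with `4N ∣ ℓ + 1` in divisibility form).
[cite: MazurRubin2010, Prop. 3.3 and Lemma 3.5] -/
theorem exists_mazurRubinPrime_of_natCard_selmerGroup_eq_two
    (W : WeierstrassCurve ℚ) [W.IsElliptic] [W.IsGloballyMinimal] [NeZero (W.conductorNorm ℤ)]
    (hCM : W.HasCM) (hin : Rank1Residual.CMInert W 2) (hρ2 : W.HasSurjectiveModNGaloisRep 2)
    (hSel : Nat.card (W.selmerGroup 2) = 2) :
    ∃ (ℓ : ℕ) (_ : Fact ℓ.Prime), ℓ % 8 = 7 ∧ (4 * W.conductorNorm ℤ : ℕ) ∣ ℓ + 1 ∧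
      ¬ W.selmerGroup 2 ≤ MazurRubin2010.strictLocalKer W ℚ_[ℓ] 2 := by
  have hΔ : W.Δ < 0 := KolyvaginEigenTwo.Δ_neg_of_cmInert_two W hCM hin hρ2
  have hN0 : W.conductorNorm ℤ ≠ 0 := NeZero.ne _
  have hN4 : 4 * W.conductorNorm ℤ ≠ 0 := by omega
  have hSel1 : Nat.card (W.selmerGroup 2) ≠ 1 := by rw [hSel]; norm_num
  obtain ⟨ℓ, hℓF, -, -, hℓ8, hℓp, hns⟩ :=
    GenusKolyTwistingPrime.exists_twistingPrime_not_selmerGroup_le_strictLocalKer W hρ2 hΔ hSel1 hN4 0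
  exact ⟨ℓ, hℓF, hℓ8, hℓp _ dvd_rfl, hns⟩

/-- **The data of a Mazur–Rubin field** (modulo Burungale–Tian 2026 and modularity).  `W` globally minimal with CM, `2` inert in the CM field,
`ρ̄_{W,2}` onto, `#Sel₂(W/ℚ) = 2`; `ℓ` a Mazur–Rubin prime of `W`; `K` imaginary quadratic with `d_K = −ℓ`, Heegner for `N_W`, `2` split.
Then `d_K` is odd `≠ −3`, `Σ_W(d_K) ≤ 1`, `#Sel₂(W^{(d_K)}/ℚ) = 1` (Mazur–Rubin Cor. 3.4 (i)) and `L(W^{(d_K)},1) ≠ 0` (Selmer corank `0` ⟹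
analytic rank `0`, Burungale–Tian; modularity). [cite: MazurRubin2010, Cor. 3.4 (i)] [cite: BurungaleTian2026, Thm. 1.1] [cite: Kramer1981, Prop. 3] -/
theorem mazurRubinField_data (hBT : burungaleTian_analyticRank_eq_zero_of_selmerCorank_eq_zero_of_hasCM) (hmod : hasEntireLFunction_rat)
    (W : WeierstrassCurve ℚ) [W.IsElliptic] [W.IsGloballyMinimal] [NeZero (W.conductorNorm ℤ)]
    (hCM : W.HasCM) (hin : Rank1Residual.CMInert W 2) (hρ2 : W.HasSurjectiveModNGaloisRep 2)
    (hSel : Nat.card (W.selmerGroup 2) = 2) {ℓ : ℕ} [Fact ℓ.Prime] (hℓ8 : ℓ % 8 = 7)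
    (hdvd : (4 * W.conductorNorm ℤ : ℕ) ∣ ℓ + 1) (hns : ¬ W.selmerGroup 2 ≤ MazurRubin2010.strictLocalKer W ℚ_[ℓ] 2)
    (K : Type) [Field K] [NumberField K] (hK : IsImaginaryQuadratic K) (hd : NumberField.discr K = -(ℓ : ℤ))
    (hH : SatisfiesHeegnerHypothesis (W.conductorNorm ℤ) K) (h2K : ((Ideal.span {(2 : ℤ)}).primesOver (𝓞 K)).ncard = 2) :
    Odd (NumberField.discr K) ∧ NumberField.discr K ≠ -3 ∧
      (∑ q ∈ (NumberField.discr K).natAbs.primeFactors,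
        ((if jacobiSym W.Δ.num q = -1 then 1 else 0) + (if jacobiSym W.Δ.num q = 1 ∧ Even (W.frobeniusTrace q) then 2 else 0)) ≤ 1) ∧
      Nat.card ((W.quadraticTwist (NumberField.discr K : ℚ)).selmerGroup 2) = 1 ∧
      (W.quadraticTwist (NumberField.discr K : ℚ)).entireLFunction 1 ≠ 0 := by
  have hℓ : ℓ.Prime := Fact.out
  have hΔ : W.Δ < 0 := KolyvaginEigenTwo.Δ_neg_of_cmInert_two W hCM hin hρ2
  have hodd : Odd (NumberField.discr K) := by
    rw [hd]
    exact (Nat.odd_iff.mpr (by omega) : Odd ℓ).natCast.neg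
  -- `ℓ ≥ 11` since `3 ≤ |d_F| ∣ N_W` and `4N_W ∣ ℓ + 1`; so `d_K ≠ −3`
  have h3 : NumberField.discr K ≠ -3 := by
    obtain ⟨hFP, hF4, -⟩ := ShaCountTwo.prime_natAbs_cmFieldDiscr_of_cmInert_two W hin
    have hFN : (cmFieldDiscrOfJ W.j).natAbs ∣ W.conductorNorm ℤ := ShaCountTwo.natAbs_cmFieldDiscr_dvd_conductorNorm W hCM hin hρ2
    have hF3 : 3 ≤ (cmFieldDiscrOfJ W.j).natAbs := by have := hFP.two_le; omega
    have hN3 : 3 ≤ W.conductorNorm ℤ := le_trans hF3 (Nat.le_of_dvd (Nat.pos_of_ne_zero (NeZero.ne _)) hFN)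
    have h12 : 12 ≤ ℓ + 1 := le_trans (by omega) (Nat.le_of_dvd (Nat.succ_pos ℓ) hdvd)
    rw [hd]
    omega
  have hd0 : ((NumberField.discr K : ℤ) : ℚ) ≠ 0 := by exact_mod_cast NumberField.discr_ne_zero K
  haveI := W.isElliptic_quadraticTwist hd0
  -- Mazur–Rubin Cor. 3.4 (i): not strict ⟹ `#Sel₂(W) = 2·#Sel₂(W^{(d_K)})`
  have hcard := (GenusKolyTwin.cor34i_twin_prime_heegner W MazurRubin2010.cor34i_singleton_rat_holds hΔ hK hodd hH h2K hd
    (W.quadraticTwist ((NumberField.discr K : ℤ) : ℚ)) ⟨1, one_smul _ _⟩).2 hns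
  rw [hSel] at hcard
  have h1 : Nat.card ((W.quadraticTwist ((NumberField.discr K : ℤ) : ℚ)).selmerGroup 2) = 1 := by omega
  have h0 : (W.quadraticTwist ((NumberField.discr K : ℤ) : ℚ)).selmerCorank 2 = 0 :=
    selmerCorank_eq_zero_of_natCard_selmerGroup_eq_one_factFree (W.quadraticTwist ((NumberField.discr K : ℤ) : ℚ)) 2 h1
  have hCMd : (W.quadraticTwist ((NumberField.discr K : ℤ) : ℚ)).HasCM :=
    (hasCM_iff_of_j_eq (W.j_quadraticTwist hd0)).mpr hCM
  have hr0 : (W.quadraticTwist ((NumberField.discr K : ℤ) : ℚ)).analyticRank = 0 :=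
    hBT (W.quadraticTwist ((NumberField.discr K : ℤ) : ℚ)) hCMd 2 h0
  have hL : (W.quadraticTwist ((NumberField.discr K : ℤ) : ℚ)).entireLFunction 1 ≠ 0 :=
    ((W.quadraticTwist ((NumberField.discr K : ℤ) : ℚ)).analyticRank_eq_zero_iff_holds (hmod _)).mp hr0
  have hq : (NumberField.discr K).natAbs.Prime := by
    rw [hd, Int.natAbs_neg, Int.natAbs_natCast]
    exact hℓ
  exact ⟨hodd, h3, sum_defect_le_one_of_prime_of_cmInert_two W hCM hin hρ2 K hK hodd hH hq, h1, hL⟩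

/-- **`Ш(W_K)(2) = ⊥` on a Mazur–Rubin frame** (mod GZ, GZK, modularity, Milne, Burungale–Tian): with `W ∈ H₂`, `r_an = 1`, `#Sel₂(W/ℚ) = 2`,
`K` a Mazur–Rubin field and `(Dt, β, ι, d₁)` a frame with `y_K` of infinite order, g15's count identity
`#Ш(W_K)(2)·2 = #Ш(W)(2)·#Ш(W^{(d_K)})(2)·2^{Σ}` with `Ш(W)(2) = ⊥` (rank `1`, `#Sel₂ = 2`), `Ш(W^{(d_K)})(2) = ⊥` (`#Sel₂ = 1`) and
`Σ ≤ 1` gives `#Ш(W_K)(2) = 1`. [cite: Kramer1981, Prop. 3] [cite: Milne1972ArithmeticAV, Thm. 1] [cite: MazurRubin2010, Cor. 3.4 (i)] -/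
theorem primaryComponent_sha_two_baseChange_eq_bot_of_mazurRubinField
    (hGZ : ∀ (N : ℕ) [NeZero N] (W : WeierstrassCurve ℚ) (K : Type) [Field K] [NumberField K], gross_zagier N W K)
    (hGZK : rank_eq_analyticRank_of_analyticRank_le_one) (hnf : exists_isNewformOf)
    (hMilneC : Milne1972.bsdQuotient_baseChange_quadratic_anyModel)
    (hBT : burungaleTian_analyticRank_eq_zero_of_selmerCorank_eq_zero_of_hasCM)
    (W : WeierstrassCurve ℚ) [W.IsElliptic] [W.IsGloballyMinimal] [NeZero (W.conductorNorm ℤ)]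
    (hCM : W.HasCM) (hin : Rank1Residual.CMInert W 2) (hρ2 : W.HasSurjectiveModNGaloisRep 2) (hr : W.analyticRank = 1)
    (hSel : Nat.card (W.selmerGroup 2) = 2) {ℓ : ℕ} [Fact ℓ.Prime] (hℓ8 : ℓ % 8 = 7)
    (hdvd : (4 * W.conductorNorm ℤ : ℕ) ∣ ℓ + 1) (hns : ¬ W.selmerGroup 2 ≤ MazurRubin2010.strictLocalKer W ℚ_[ℓ] 2)
    (K : Type) [Field K] [NumberField K] (hK : IsImaginaryQuadratic K) (hd : NumberField.discr K = -(ℓ : ℤ))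
    (hH : SatisfiesHeegnerHypothesis (W.conductorNorm ℤ) K) (h2K : ((Ideal.span {(2 : ℤ)}).primesOver (𝓞 K)).ncard = 2)
    (Dt : ModularParametrizationData W (W.conductorNorm ℤ)) (β : ℤ) (ι : K →+* ℂ) (d₁ : KolyvaginHeegnerData Dt β ι 1)
    (hy : ¬ IsOfFinAddOrder d₁.derivedPoint) :
    Nat.card (AddCommGroup.primaryComponent (W.baseChange K).sha 2) = 1 ∧
      AddCommGroup.primaryComponent (W.baseChange K).sha 2 = ⊥ := by
  haveI : Fact (Nat.Prime 2) := ⟨Nat.prime_two⟩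
  have hmod : hasEntireLFunction_rat := hasEntireLFunction_rat_of_exists_isNewformOf hnf
  have hΔ : W.Δ < 0 := KolyvaginEigenTwo.Δ_neg_of_cmInert_two W hCM hin hρ2
  obtain ⟨hodd, -, hdef, h1, -⟩ := mazurRubinField_data hBT hmod W hCM hin hρ2 hSel hℓ8 hdvd hns K hK hd hH h2K
  have hd0 : ((NumberField.discr K : ℤ) : ℚ) ≠ 0 := by exact_mod_cast NumberField.discr_ne_zero K
  haveI := W.isElliptic_quadraticTwist hd0
  have hShaW : AddCommGroup.primaryComponent W.sha 2 = ⊥ :=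
    (natCard_selmerGroup_two_eq_two_iff_primaryComponent_sha_two_eq_bot hGZK W hρ2 hr).mp hSel
  have hShaD : AddCommGroup.primaryComponent (W.quadraticTwist ((NumberField.discr K : ℤ) : ℚ)).sha 2 = ⊥ :=
    primaryComponent_sha_eq_bot_of_natCard_selmerGroup_eq_one (W.quadraticTwist ((NumberField.discr K : ℤ) : ℚ)) 2 h1
  obtain ⟨-, hid⟩ := ShaCountTwo.card_primaryComponent_sha_two_baseChange_mul_two_eq_of_heegnerData_of_facts hGZ hGZK hmod hMilneC
    W hρ2 K hK hodd hH Dt β ι d₁ hy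
  rw [if_neg (not_lt.mpr hΔ.le), hShaW, hShaD, AddSubgroup.card_bot, AddSubgroup.card_bot, one_mul, mul_one, one_mul] at hid
  have hpow1 : 1 ≤ 2 ^ ∑ q ∈ (NumberField.discr K).natAbs.primeFactors,
      ((if jacobiSym W.Δ.num q = -1 then 1 else 0) + (if jacobiSym W.Δ.num q = 1 ∧ Even (W.frobeniusTrace q) then 2 else 0)) :=
    Nat.one_le_two_pow
  have hpow2 : 2 ^ ∑ q ∈ (NumberField.discr K).natAbs.primeFactors,
      ((if jacobiSym W.Δ.num q = -1 then 1 else 0) + (if jacobiSym W.Δ.num q = 1 ∧ Even (W.frobeniusTrace q) then 2 else 0)) ≤ 2 ^ 1 :=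
    Nat.pow_le_pow_right (by norm_num) hdef
  have hshaK : Nat.card (AddCommGroup.primaryComponent (W.baseChange K).sha 2) = 1 := by
    rw [pow_one] at hpow2
    omega
  haveI hfinK : Finite (AddCommGroup.primaryComponent (W.baseChange K).sha 2) := Nat.finite_of_card_ne_zero (by omega)
  exact ⟨hshaK, AddSubgroup.eq_bot_of_card_eq _ hshaK⟩

/-! ## §2 R0 at the Mazur–Rubin primes ⟹ `BSD₂(E)` on `#Sel₂(E) = 2` -/

/-- **`BSD₂(E)` on `#Sel₂(E/ℚ) = 2` FROM R0 AT THE MAZUR–RUBIN PRIMES OF `E` ONLY** (and six prints: GZ all levels, GZK, modularity, Milne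
any-model, Burungale–Flach, Burungale–Tian).  `hR0MR`: for every Mazur–Rubin prime `ℓ` of `W` (prime, `≡ 7 (mod 8)`, `4N_W ∣ ℓ + 1`, `Sel₂(W)`
not strict at `ℓ`), every imaginary quadratic `K` with `d_K = −ℓ`, Heegner for `N_W`, `2` split in `K`, and every optimal odd-Manin frame
`(Dt, β, ι, d₁)` with `y_K = P(1)` of infinite order: `y_K ∉ 2W(K[1])`.  NO `Ш`-hypothesis (it is automatic, §1).  Proof: a Mazur–Rubin prime
exists (§1); its field has `Ш(W_K)(2) = ⊥`; the frame is built by Darmon 3.6 / Gross–Zagier; `hR0MR` gives `M₀ = 0`; g0's exact descent with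
Burungale–Flach for the twin concludes.  CONDITIONAL on `hR0MR` (open) and the prints; closes nothing by name.
[cite: MazurRubin2010, Cor. 3.4 (i)] [cite: BurungaleTian2026, Thm. 1.1] [cite: BurungaleFlach2024, Thm. 1.1 and Cor. 2] [cite: GrossZagier1986, V.§2]
[cite: Milne1972ArithmeticAV, Thm. 1] [cite: Darmon2004, Thm. 3.6] -/
theorem bsdp_two_of_natCard_selmerGroup_eq_two_of_mazurRubinPrimeR0_of_printedInputs
    (hGZ : ∀ (N : ℕ) [NeZero N] (W : WeierstrassCurve ℚ) (K : Type) [Field K] [NumberField K], gross_zagier N W K)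
    (hGZK : rank_eq_analyticRank_of_analyticRank_le_one) (hnf : exists_isNewformOf)
    (hMilneC : Milne1972.bsdQuotient_baseChange_quadratic_anyModel) (hBF : bsdTriple_of_hasCM_of_L_one_ne_zero)
    (hBT : burungaleTian_analyticRank_eq_zero_of_selmerCorank_eq_zero_of_hasCM)
    (W : WeierstrassCurve ℚ) [W.IsElliptic] [W.IsGloballyMinimal] [NeZero (W.conductorNorm ℤ)]
    (hCM : W.HasCM) (hin : Rank1Residual.CMInert W 2) (hρ2 : W.HasSurjectiveModNGaloisRep 2) (hr : W.analyticRank = 1)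
    (hT : Odd W.tamagawaProduct)
    (hopt : ∃ Dt : ModularParametrizationData W (W.conductorNorm ℤ),
      (∀ z ∈ Dt.L.lattice, ∃ w ∈ periodLattice Dt.f, z = (Dt.c : ℂ) * w) ∧ Odd Dt.c)
    (hSel : Nat.card (W.selmerGroup 2) = 2)
    (hR0MR : ∀ (ℓ : ℕ) [Fact ℓ.Prime], ℓ % 8 = 7 → (4 * W.conductorNorm ℤ : ℕ) ∣ ℓ + 1 →
      ¬ W.selmerGroup 2 ≤ MazurRubin2010.strictLocalKer W ℚ_[ℓ] 2 →
      ∀ (K : Type) [Field K] [NumberField K], IsImaginaryQuadratic K → NumberField.discr K = -(ℓ : ℤ) →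
      SatisfiesHeegnerHypothesis (W.conductorNorm ℤ) K → ((Ideal.span {(2 : ℤ)}).primesOver (𝓞 K)).ncard = 2 →
      ∀ (Dt : ModularParametrizationData W (W.conductorNorm ℤ)),
      (∀ z ∈ Dt.L.lattice, ∃ w ∈ periodLattice Dt.f, z = (Dt.c : ℂ) * w) → Odd Dt.c →
      ∀ (β : ℤ) (ι : K →+* ℂ) (d₁ : KolyvaginHeegnerData Dt β ι 1), ¬ IsOfFinAddOrder d₁.derivedPoint →
      ¬ ∃ Q : (W.baseChange (ringClassField K ι 1)).toAffine.Point, (2 : ℤ) • Q = d₁.derivedPoint) :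
    BSDp W 2 := by
  haveI : Fact (Nat.Prime 2) := ⟨Nat.prime_two⟩
  have hmod : hasEntireLFunction_rat := hasEntireLFunction_rat_of_exists_isNewformOf hnf
  -- a Mazur–Rubin prime `ℓ` and its field `K = ℚ(√−ℓ)`
  obtain ⟨ℓ, hℓF, hℓ8, hdvd, hns⟩ := exists_mazurRubinPrime_of_natCard_selmerGroup_eq_two W hCM hin hρ2 hSel
  have hℓ : ℓ.Prime := hℓF.out
  have hℓN' : ∀ p : ℕ, p.Prime → p ∣ W.conductorNorm ℤ → p ≠ 2 → (ℓ : ZMod p) = -1 := by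
    intro p _ hp _
    have h : ((ℓ + 1 : ℕ) : ZMod p) = 0 := (ZMod.natCast_eq_zero_iff _ _).mpr ((Dvd.dvd.mul_left hp 4).trans hdvd)
    rw [Nat.cast_add, Nat.cast_one] at h
    exact eq_neg_of_add_eq_zero_left h
  obtain ⟨-, -, K, _, _, hK, hd, hodd, h3, hH, h2K, -, -⟩ := GenusKolyTwin.exists_heegnerField_of_prime W hℓ hℓ8 hℓN'
  obtain ⟨-, -, -, -, hL⟩ := mazurRubinField_data hBT hmod W hCM hin hρ2 hSel hℓ8 hdvd hns K hK hd hH h2K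
  -- the frame
  obtain ⟨Dt, hDt, hc⟩ := hopt
  obtain ⟨β, hβ⟩ := exists_dvd_sq_sub_discr_holds (W.conductorNorm ℤ) K hK hH
  let ι : K →+* ℂ := Classical.choice inferInstance
  obtain ⟨d₁⟩ := exists_kolyvaginHeegnerData_one
    (phi_heegnerTau_mem_singularModuliField_holds (W.conductorNorm ℤ) W K) hK Dt β ι hβ
  have hy : ¬ IsOfFinAddOrder d₁.derivedPoint :=
    CMSupply.not_isOfFinAddOrder_derivedPoint_one_of_rankOne hnf W K (hGZ _ W K) hK hH hr hL d₁
  -- `#Ш(W_K)(2) = 1 = 2^{2·0}`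
  obtain ⟨hshaK, -⟩ := primaryComponent_sha_two_baseChange_eq_bot_of_mazurRubinField hGZ hGZK hnf hMilneC hBT W hCM hin hρ2 hr hSel
    hℓ8 hdvd hns K hK hd hH h2K Dt β ι d₁ hy
  have hshaK' : Nat.card (AddCommGroup.primaryComponent (W.baseChange K).sha 2) = 2 ^ (2 * 0) := by
    rw [mul_zero, pow_zero]
    exact hshaK
  -- R0 at the Mazur–Rubin prime: `M₀ = 0`
  have hprim : ¬ ∃ Q : (W.baseChange (ringClassField K ι 1)).toAffine.Point, (2 : ℤ) • Q = d₁.derivedPoint :=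
    hR0MR ℓ hℓ8 hdvd hns K hK hd hH h2K Dt hDt hc β ι d₁ hy
  have hM₀ : ∃ Q : (W.baseChange (ringClassField K ι 1)).toAffine.Point, ((2 ^ 0 : ℕ) : ℤ) • Q = d₁.derivedPoint :=
    ⟨d₁.derivedPoint, by rw [pow_zero, Nat.cast_one, one_smul]⟩
  have hndiv : ¬ ∃ Q : (W.baseChange (ringClassField K ι 1)).toAffine.Point, ((2 ^ (0 + 1) : ℕ) : ℤ) • Q = d₁.derivedPoint := by
    rw [zero_add, pow_one]
    exact_mod_cast hprim
  -- the twin and g0's exact descent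
  obtain ⟨Wd, _, _, hWd, hcmd, hrd⟩ := CMSupply.exists_minimal_twin_hasCM_analyticRank_zero hnf W hCM K hL
  have hBd : BSDp Wd 2 := Summit.BirchSwinnertonDyer.Rank1Residual.bsdp_cm_rankZero (p := 2) hBF hmod hcmd hrd
  exact cmExactDescentAtTwo_of_facts hGZ hGZK hmod hMilneC W hCM hin hρ2 hr hT K hK hodd h3 hH Dt hDt hc β ι d₁ hy 0 hM₀ hndiv hshaK'
    Wd hWd hBd

/-- **One Mazur–Rubin prime decides**: if for SOME Mazur–Rubin prime `ℓ` of `W`, some `K` with `d_K = −ℓ` (Heegner, `2` split) and some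
optimal odd-Manin frame the Heegner point `y_K = P(1)` is of infinite order and NOT `2`-divisible in `W(K[1])`, then `BSDp W 2` (six prints).
(Same chain as above for the given `ℓ`.) [cite: MazurRubin2010, Cor. 3.4 (i)] [cite: BurungaleFlach2024, Cor. 2] [cite: GrossZagier1986, V.§2] -/
theorem bsdp_two_of_exists_mazurRubinPrime_primitive_of_printedInputs
    (hGZ : ∀ (N : ℕ) [NeZero N] (W : WeierstrassCurve ℚ) (K : Type) [Field K] [NumberField K], gross_zagier N W K)
    (hGZK : rank_eq_analyticRank_of_analyticRank_le_one) (hnf : exists_isNewformOf)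
    (hMilneC : Milne1972.bsdQuotient_baseChange_quadratic_anyModel) (hBF : bsdTriple_of_hasCM_of_L_one_ne_zero)
    (hBT : burungaleTian_analyticRank_eq_zero_of_selmerCorank_eq_zero_of_hasCM)
    (W : WeierstrassCurve ℚ) [W.IsElliptic] [W.IsGloballyMinimal] [NeZero (W.conductorNorm ℤ)]
    (hCM : W.HasCM) (hin : Rank1Residual.CMInert W 2) (hρ2 : W.HasSurjectiveModNGaloisRep 2) (hr : W.analyticRank = 1)
    (hT : Odd W.tamagawaProduct) (hSel : Nat.card (W.selmerGroup 2) = 2)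
    {ℓ : ℕ} [Fact ℓ.Prime] (hℓ8 : ℓ % 8 = 7) (hdvd : (4 * W.conductorNorm ℤ : ℕ) ∣ ℓ + 1)
    (hns : ¬ W.selmerGroup 2 ≤ MazurRubin2010.strictLocalKer W ℚ_[ℓ] 2)
    (K : Type) [Field K] [NumberField K] (hK : IsImaginaryQuadratic K) (hd : NumberField.discr K = -(ℓ : ℤ))
    (hH : SatisfiesHeegnerHypothesis (W.conductorNorm ℤ) K) (h2K : ((Ideal.span {(2 : ℤ)}).primesOver (𝓞 K)).ncard = 2)
    (Dt : ModularParametrizationData W (W.conductorNorm ℤ))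
    (hDt : ∀ z ∈ Dt.L.lattice, ∃ w ∈ periodLattice Dt.f, z = (Dt.c : ℂ) * w) (hc : Odd Dt.c)
    (β : ℤ) (ι : K →+* ℂ) (d₁ : KolyvaginHeegnerData Dt β ι 1) (hy : ¬ IsOfFinAddOrder d₁.derivedPoint)
    (hprim : ¬ ∃ Q : (W.baseChange (ringClassField K ι 1)).toAffine.Point, (2 : ℤ) • Q = d₁.derivedPoint) :
    BSDp W 2 := by
  haveI : Fact (Nat.Prime 2) := ⟨Nat.prime_two⟩
  have hmod : hasEntireLFunction_rat := hasEntireLFunction_rat_of_exists_isNewformOf hnf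
  obtain ⟨hodd, h3, -, -, hL⟩ := mazurRubinField_data hBT hmod W hCM hin hρ2 hSel hℓ8 hdvd hns K hK hd hH h2K
  obtain ⟨hshaK, -⟩ := primaryComponent_sha_two_baseChange_eq_bot_of_mazurRubinField hGZ hGZK hnf hMilneC hBT W hCM hin hρ2 hr hSel
    hℓ8 hdvd hns K hK hd hH h2K Dt β ι d₁ hy
  have hshaK' : Nat.card (AddCommGroup.primaryComponent (W.baseChange K).sha 2) = 2 ^ (2 * 0) := by
    rw [mul_zero, pow_zero]
    exact hshaK
  have hM₀ : ∃ Q : (W.baseChange (ringClassField K ι 1)).toAffine.Point, ((2 ^ 0 : ℕ) : ℤ) • Q = d₁.derivedPoint :=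
    ⟨d₁.derivedPoint, by rw [pow_zero, Nat.cast_one, one_smul]⟩
  have hndiv : ¬ ∃ Q : (W.baseChange (ringClassField K ι 1)).toAffine.Point, ((2 ^ (0 + 1) : ℕ) : ℤ) • Q = d₁.derivedPoint := by
    rw [zero_add, pow_one]
    exact_mod_cast hprim
  obtain ⟨Wd, _, _, hWd, hcmd, hrd⟩ := CMSupply.exists_minimal_twin_hasCM_analyticRank_zero hnf W hCM K hL
  have hBd : BSDp Wd 2 := Summit.BirchSwinnertonDyer.Rank1Residual.bsdp_cm_rankZero (p := 2) hBF hmod hcmd hrd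
  exact cmExactDescentAtTwo_of_facts hGZ hGZK hmod hMilneC W hCM hin hρ2 hr hT K hK hodd h3 hH Dt hDt hc β ι d₁ hy 0 hM₀ hndiv hshaK'
    Wd hWd hBd

/-! ## §3 The converse: `BSD₂(E)` ⟹ R0 at every Mazur–Rubin prime (per-curve BSD-truth) -/

/-- **`BSDp W 2` ⟹ R0 at every Mazur–Rubin prime of `W`** (six prints).  On a Mazur–Rubin frame `Ш(W_K)(2) = ⊥` (§1); if `y_K` were
`2`-divisible its exact exponent `M₀` would be `≥ 1`, while g21's consistency identity (`BSDp Wd 2 → BSDp W 2 → #Ш(W_K)(2) = 2^{2M₀}`,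
`card_primaryComponent_sha_two_baseChange_eq_pow_of_bsdp_of_printedInputs`) gives `1 = 2^{2M₀}`.  (= g23's p765765 per curve, on MR frames.)
[cite: GrossZagier1986, I.6.3 and V.2] [cite: BurungaleFlach2024, Cor. 2] [cite: MazurRubin2010, Cor. 3.4 (i)] -/
theorem mazurRubinPrimeR0_of_bsdp_of_printedInputs
    (hGZ : ∀ (N : ℕ) [NeZero N] (W : WeierstrassCurve ℚ) (K : Type) [Field K] [NumberField K], gross_zagier N W K)
    (hGZK : rank_eq_analyticRank_of_analyticRank_le_one) (hnf : exists_isNewformOf)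
    (hMilneC : Milne1972.bsdQuotient_baseChange_quadratic_anyModel) (hBF : bsdTriple_of_hasCM_of_L_one_ne_zero)
    (hBT : burungaleTian_analyticRank_eq_zero_of_selmerCorank_eq_zero_of_hasCM)
    (W : WeierstrassCurve ℚ) [W.IsElliptic] [W.IsGloballyMinimal] [NeZero (W.conductorNorm ℤ)]
    (hCM : W.HasCM) (hin : Rank1Residual.CMInert W 2) (hρ2 : W.HasSurjectiveModNGaloisRep 2) (hr : W.analyticRank = 1)
    (hT : Odd W.tamagawaProduct) (hSel : Nat.card (W.selmerGroup 2) = 2) (hBW : BSDp W 2)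
    {ℓ : ℕ} [Fact ℓ.Prime] (hℓ8 : ℓ % 8 = 7) (hdvd : (4 * W.conductorNorm ℤ : ℕ) ∣ ℓ + 1)
    (hns : ¬ W.selmerGroup 2 ≤ MazurRubin2010.strictLocalKer W ℚ_[ℓ] 2)
    (K : Type) [Field K] [NumberField K] (hK : IsImaginaryQuadratic K) (hd : NumberField.discr K = -(ℓ : ℤ))
    (hH : SatisfiesHeegnerHypothesis (W.conductorNorm ℤ) K) (h2K : ((Ideal.span {(2 : ℤ)}).primesOver (𝓞 K)).ncard = 2)
    (Dt : ModularParametrizationData W (W.conductorNorm ℤ)) (hc : Odd Dt.c)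
    (β : ℤ) (ι : K →+* ℂ) (d₁ : KolyvaginHeegnerData Dt β ι 1) (hy : ¬ IsOfFinAddOrder d₁.derivedPoint) :
    ¬ ∃ Q : (W.baseChange (ringClassField K ι 1)).toAffine.Point, (2 : ℤ) • Q = d₁.derivedPoint := by
  rintro ⟨Q, hQ⟩
  haveI : Fact (Nat.Prime 2) := ⟨Nat.prime_two⟩
  have hmod : hasEntireLFunction_rat := hasEntireLFunction_rat_of_exists_isNewformOf hnf
  obtain ⟨hodd, h3, -, -, hL⟩ := mazurRubinField_data hBT hmod W hCM hin hρ2 hSel hℓ8 hdvd hns K hK hd hH h2K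
  obtain ⟨-, hbot⟩ := primaryComponent_sha_two_baseChange_eq_bot_of_mazurRubinField hGZ hGZK hnf hMilneC hBT W hCM hin hρ2 hr hSel
    hℓ8 hdvd hns K hK hd hH h2K Dt β ι d₁ hy
  -- the exact exponent `M₀`
  haveI : NumberField (ringClassField K ι 1) := numberField_ringClassField hK ι one_ne_zero
  haveI : (W.baseChange (ringClassField K ι 1)).IsElliptic := by rw [baseChange]; infer_instance
  haveI : Module.Finite ℤ (W.baseChange (ringClassField K ι 1)).toAffine.Point := by
    convert (W.baseChange (ringClassField K ι 1)).module_finite_point_holds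
  obtain ⟨M₀, hdiv, hndiv⟩ := exists_pow_smul_eq_and_not_of_not_isOfFinAddOrder Nat.prime_two hy
  -- the twin's BSD₂ (Burungale–Flach) and g21's consistency identity
  obtain ⟨Wd, _, _, hWd, hcmd, hrd⟩ := CMSupply.exists_minimal_twin_hasCM_analyticRank_zero hnf W hCM K hL
  have hBd : BSDp Wd 2 := Summit.BirchSwinnertonDyer.Rank1Residual.bsdp_cm_rankZero (p := 2) hBF hmod hcmd hrd
  have hcard := KolyvaginGenusTwo.card_primaryComponent_sha_two_baseChange_eq_pow_of_bsdp_of_printedInputs hGZ hGZK hmod hMilneC W hρ2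
    hr hT K hK hodd h3 hH Dt hc β ι d₁ hy M₀ hdiv hndiv Wd hWd hBd hBW
  rw [hbot, AddSubgroup.card_bot] at hcard
  have hM : M₀ = 0 := by
    have h := (Nat.pow_eq_one.mp hcard.symm).resolve_left (by norm_num)
    omega
  subst hM
  exact hndiv ⟨Q, by simpa using hQ⟩

/-! ## §4 The characterization -/

/-- **ON `H₂ ∩ {Ш(E/ℚ)[2] = 0}`, `BSD₂(E)` ⟺ R0 AT THE MAZUR–RUBIN PRIMES OF `E`** (mod six prints: GZ, GZK, modularity, Milne any-model,
Burungale–Flach, Burungale–Tian).  For a framed `W ∈ H₂` (CM, `2` inert, `ρ̄₂` onto, `r_an = 1`, odd Tamagawa, optimal odd-Manin frame) with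
`#Sel₂(W/ℚ) = 2`: `BSDp W 2` holds iff for every Mazur–Rubin prime `ℓ`, every `K` with `d_K = −ℓ` (Heegner, `2` split) and every optimal
odd-Manin frame with `y_K` of infinite order, `y_K ∉ 2W(K[1])`.  (And one such prime/frame suffices: §2.)  This is the exact per-curve
content of the route's open input on the cell `Ш(E/ℚ)[2] = 0`.  BSD is NOT proved by this. [cite: MazurRubin2010, Cor. 3.4 (i)]
[cite: BurungaleTian2026, Thm. 1.1] [cite: BurungaleFlach2024, Cor. 2] [cite: KrizLi2019, §1.3 (the frame: 2 split in K)] -/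
theorem bsdp_two_iff_mazurRubinPrimeR0_of_printedInputs
    (hGZ : ∀ (N : ℕ) [NeZero N] (W : WeierstrassCurve ℚ) (K : Type) [Field K] [NumberField K], gross_zagier N W K)
    (hGZK : rank_eq_analyticRank_of_analyticRank_le_one) (hnf : exists_isNewformOf)
    (hMilneC : Milne1972.bsdQuotient_baseChange_quadratic_anyModel) (hBF : bsdTriple_of_hasCM_of_L_one_ne_zero)
    (hBT : burungaleTian_analyticRank_eq_zero_of_selmerCorank_eq_zero_of_hasCM)
    (W : WeierstrassCurve ℚ) [W.IsElliptic] [W.IsGloballyMinimal] [NeZero (W.conductorNorm ℤ)]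
    (hCM : W.HasCM) (hin : Rank1Residual.CMInert W 2) (hρ2 : W.HasSurjectiveModNGaloisRep 2) (hr : W.analyticRank = 1)
    (hT : Odd W.tamagawaProduct)
    (hopt : ∃ Dt : ModularParametrizationData W (W.conductorNorm ℤ),
      (∀ z ∈ Dt.L.lattice, ∃ w ∈ periodLattice Dt.f, z = (Dt.c : ℂ) * w) ∧ Odd Dt.c)
    (hSel : Nat.card (W.selmerGroup 2) = 2) :
    BSDp W 2 ↔
      ∀ (ℓ : ℕ) [Fact ℓ.Prime], ℓ % 8 = 7 → (4 * W.conductorNorm ℤ : ℕ) ∣ ℓ + 1 →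
        ¬ W.selmerGroup 2 ≤ MazurRubin2010.strictLocalKer W ℚ_[ℓ] 2 →
        ∀ (K : Type) [Field K] [NumberField K], IsImaginaryQuadratic K → NumberField.discr K = -(ℓ : ℤ) →
        SatisfiesHeegnerHypothesis (W.conductorNorm ℤ) K → ((Ideal.span {(2 : ℤ)}).primesOver (𝓞 K)).ncard = 2 →
        ∀ (Dt : ModularParametrizationData W (W.conductorNorm ℤ)),
        (∀ z ∈ Dt.L.lattice, ∃ w ∈ periodLattice Dt.f, z = (Dt.c : ℂ) * w) → Odd Dt.c →
        ∀ (β : ℤ) (ι : K →+* ℂ) (d₁ : KolyvaginHeegnerData Dt β ι 1), ¬ IsOfFinAddOrder d₁.derivedPoint →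
        ¬ ∃ Q : (W.baseChange (ringClassField K ι 1)).toAffine.Point, (2 : ℤ) • Q = d₁.derivedPoint :=
  ⟨fun hBW _ _ hℓ8 hdvd hns K _ _ hK hd hH h2K Dt _ hc β ι d₁ hy ↦
      mazurRubinPrimeR0_of_bsdp_of_printedInputs hGZ hGZK hnf hMilneC hBF hBT W hCM hin hρ2 hr hT hSel hBW hℓ8 hdvd hns K hK hd hH h2K
        Dt hc β ι d₁ hy,
    fun h ↦ bsdp_two_of_natCard_selmerGroup_eq_two_of_mazurRubinPrimeR0_of_printedInputs hGZ hGZK hnf hMilneC hBF hBT W hCM hin hρ2 hr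
      hT hopt hSel (fun ℓ _ hℓ8 hdvd hns K _ _ hK hd hH h2K Dt hDt hc β ι d₁ hy ↦ h ℓ hℓ8 hdvd hns K hK hd hH h2K Dt hDt hc β ι d₁ hy)⟩

end Summit.BirchSwinnertonDyer.BirchSwinnertonDyer.Theorems.KolyvaginLowerTwo

end
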